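import Summits.QuantumFields.YangMills.Theorems.UnitScaleTiltProp7CovKernel157Member
import HarnessLib

/-!
# Route `UnitScaleTilt`, crux K1 «MinimiserStabilityRegPr» (stmt-QuantumFields-19200), EX display (S16ᴰ∕S20ᴸ–S22ᴸ) — file F-5b:
# **THE (157)-twˢ ENTRY ROW `hC157` IS A THEOREM (`g L := 10¹¹L⁵`), HENCE S16ᴰ's BINDER `hCcol` IS DISCHARGED** modulo the family windows
# `hα hef hWe hWε hdomC` of the display and the two NEW L-only windows `10¹¹L⁶·ef L ≤ 1`, `10¹⁶L⁵·α L ≤ 1` of the C-ENTRY line (Cauchy route)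

Cell `ym3-torus` (HUMAN RULING D-0037: YM₃ on T³ is ladder rung R3, not the Clay problem), width seat `ym3-torus-px18` gen 3; ★w2-19200 g8 «C-ENTRY GO» (F-1…F-5).
`--supports stmt-QuantumFields-19200 --as helper`; def-free, 0 sorry; count-neutral.

* ★★★ `hC157_family` — the hypothesis `hC157` of ✓`Prop7CcolOf157Entry.hCcol_of_157_family` VERBATIM at `g L := 10¹¹L⁵`, from F-5a ✓`Prop7CovKernel157Member.norm_fderiv_CmapTwS_apply_le_of_regPr`
  at the member `i : Idx L` (radius `e := εC L + a₃ L ≤ ef L∕4` by `hdomC`; the empty ball when `e ≤ 0`).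
* ★★★ `hCcol_family` — S16ᴰ's `hCcol` VERBATIM at `G L := 6·10¹¹L⁵` (✓`hCcol_of_157_family` ∘ `hC157_family`): the C-column of the EX display needs no displayed (157) row any more.
HONEST SCOPE.  Binder plumbing over F-5a and the door; the two extra windows are DISPLAYED hypotheses for the numerals census (S25∕S26) to inhabit; nothing of EX, E′ or the crux is
claimed; rung R3, not d = 4; YM gap NOT proved.

References: T. Bałaban, CMP **98** (1985) 17–51 [Balaban1985Averaging] (Prop. 5 (157) p.42); CMP **102** (1985) 277–309 [Balaban1985Variational] ((2) p.278, (44) p.285, (115) p.294).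
-/

noncomputable section

open scoped Matrix.Norms.L2Operator BigOperators
open NormedSpace Metric Set

namespace Summit.QuantumFields.YangMills.Theorems.Prop7CovKernel157Family

open Literature.MathematicalPhysics.QuantumFieldTheory.Balaban1983to89
open Literature.MathematicalPhysics.QuantumFieldTheory.Balaban1983to89.T3ContinuumYM3Torus
open Literature.MathematicalPhysics.QuantumFieldTheory.Balaban1983to89.T3Thm1Carrier
open T3PrintedRegularMinimiser (RegPr)
open T3SectALandauChart (eta eta_pos)
open B9SectCLatticeCarrier (Bond)
open B11Eq115Space (NegSup NegSize Space115 JetSup levWeight)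
open B11Eq111FrakG (nabla115)
open B11Eq90Transpose (single115)
open Summit.QuantumFields.YangMills.Theorems.Prop7SectET3Transport (periodsT3 bondEquiv bgOfCfg cfgEquiv)
open Summit.QuantumFields.YangMills.Theorems.Prop7SymAvgTwSym (CmapTwS)
open Summit.QuantumFields.YangMills.Theorems.Prop7CcolOf157Entry (hCcol_of_157_family)
open Summit.QuantumFields.YangMills.Theorems.Prop7CovKernel157Member (norm_fderiv_CmapTwS_apply_le_of_regPr)

/-- ★★★ **THE (157)-twˢ ENTRY ROW OF THE EX DISPLAY IS A THEOREM** (`g L := 10¹¹L⁵`): for every `L > 1`, member `i : Idx L`, `U₀ ∈ 𝔘_k(α L)`, `‖B‖ < (εC L + a₃ L)·η`, direction `δ`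
vanishing off one fine bond, coarse bond `c`: `‖(fderiv ℂ (C^{twS}(U₀)) B δ)(c)‖ ≤ 10¹¹L⁵·(L^{K−n})⁻¹·‖B‖·‖δ‖` — under the display's windows `hWe hWε hdomC` and the two new
L-only windows `10¹¹L⁶·ef L ≤ 1`, `10¹⁶L⁵·α L ≤ 1`. [cite: Balaban1985Averaging, Prop. 5 (157) p.42; Balaban1985Variational, (2) p.278, (44) p.285] -/
theorem hC157_family (α a₃ εC ef : ℕ → ℝ)
    (hα : ∀ L, 1 < L → 0 < α L)
    (hWe : ∀ L : ℕ, 1 < L → 10 ^ 9 * (L : ℝ) ^ 2 * ef L ≤ 1) (hWε : ∀ L : ℕ, 1 < L → 10 ^ 12 * (L : ℝ) ^ 3 * α L ≤ 1)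
    (hdomC : ∀ L : ℕ, 1 < L → 2 * (εC L + a₃ L) ≤ ef L / 2)
    (hWe'' : ∀ L : ℕ, 1 < L → 10 ^ 11 * (L : ℝ) ^ 6 * ef L ≤ 1) (hWε'' : ∀ L : ℕ, 1 < L → 10 ^ 16 * (L : ℝ) ^ 5 * α L ≤ 1) :
    ∀ (L : ℕ), 1 < L → ∀ (i : Idx L) (U₀ : GaugeField (i.1.1.P i.1.2.2) 0 (Matrix.specialUnitaryGroup (Fin 2) ℂ)), RegPr i.1.1 i.1.2.1 i.1.2.2 (α L) U₀ →
      ∀ B : PBond (i.1.1.P i.1.2.2) 0 → Matrix (Fin 2) (Fin 2) ℂ, ‖B‖ < (εC L + a₃ L) * eta i.1.1 i.1.2.1 i.1.2.2 →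
      ∀ (b₀ : PBond (i.1.1.P i.1.2.2) 0) (δ : PBond (i.1.1.P i.1.2.2) 0 → Matrix (Fin 2) (Fin 2) ℂ), (∀ b, b ≠ b₀ → δ b = 0) →
      ∀ c : PBond (i.1.1.P i.1.2.1) 0, ‖fderiv ℂ (CmapTwS i.1.1 i.1.2.1 i.1.2.2 i.2.2.le U₀) B δ c‖ ≤ (10 ^ 11 * (L : ℝ) ^ 5) * ((L : ℝ) ^ (i.1.2.2 - i.1.2.1))⁻¹ * ‖B‖ * ‖δ‖ := by
  intro L hL i U₀ hreg B hB b₀ δ hδ c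
  have hLi : (L : ℝ) = (i.1.1.L : ℝ) := by rw [i.2.1]
  by_cases he : 0 < εC L + a₃ L
  · have hef4 : εC L + a₃ L ≤ ef L / 4 := by linarith [hdomC L hL]
    have hL0 : (0 : ℝ) < (L : ℝ) := by exact_mod_cast (show 0 < L by omega)
    have hWe1 : 10 ^ 9 * (i.1.1.L : ℝ) ^ 2 * (εC L + a₃ L) ≤ 1 := by
      rw [← hLi]
      have := mul_le_mul_of_nonneg_left hef4 (by positivity : (0 : ℝ) ≤ 10 ^ 9 * (L : ℝ) ^ 2)
      linarith [hWe L hL]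
    have hWe2 : 10 ^ 11 * (i.1.1.L : ℝ) ^ 6 * (εC L + a₃ L) ≤ 1 := by
      rw [← hLi]
      have := mul_le_mul_of_nonneg_left hef4 (by positivity : (0 : ℝ) ≤ 10 ^ 11 * (L : ℝ) ^ 6)
      linarith [hWe'' L hL]
    have hWε1 : 10 ^ 12 * (i.1.1.L : ℝ) ^ 3 * α L ≤ 1 := by rw [← hLi]; exact hWε L hL
    have hWε2 : 10 ^ 16 * (i.1.1.L : ℝ) ^ 5 * α L ≤ 1 := by rw [← hLi]; exact hWε'' L hL
    have h := norm_fderiv_CmapTwS_apply_le_of_regPr i.1.1 i.2.2 (hα L hL) he hWe1 hWε1 hWe2 hWε2 U₀ hreg B hB b₀ δ hδ c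
    rw [← hLi] at h
    exact h
  · exfalso
    have h0 : (εC L + a₃ L) * eta i.1.1 i.1.2.1 i.1.2.2 ≤ 0 := mul_nonpos_of_nonpos_of_nonneg (not_lt.1 he) (eta_pos i.1.1 i.1.2.1 i.1.2.2).le
    exact absurd (hB.trans_le h0) (not_lt.2 (norm_nonneg B))

/-- ★★★ **S16ᴰ's BINDER `hCcol` DISCHARGED** (VERBATIM at `G L := 6·(10¹¹L⁵)`): ✓`hCcol_of_157_family` at `g L := 10¹¹L⁵` with its displayed (157)-twˢ row supplied by `hC157_family`.
[cite: Balaban1985Averaging, Prop. 5 (157) p.42; Balaban1985Variational, (44) p.285, (72)–(73) p.289, (86) p.291, (115) p.294] -/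
theorem hCcol_family
    [hFL : ∀ F : T3Family, Fact (0 < (F.L : ℝ))] [hFη : ∀ (F : T3Family) (k : ℕ), Fact (0 < ((F.L : ℝ)⁻¹) ^ k)]
    (α a₃ εC ef : ℕ → ℝ)
    (hα : ∀ L, 1 < L → 0 < α L) (hef : ∀ L, 1 < L → 0 < ef L)
    (hWe : ∀ L : ℕ, 1 < L → 10 ^ 9 * (L : ℝ) ^ 2 * ef L ≤ 1) (hWε : ∀ L : ℕ, 1 < L → 10 ^ 12 * (L : ℝ) ^ 3 * α L ≤ 1)
    (hdomC : ∀ L : ℕ, 1 < L → 2 * (εC L + a₃ L) ≤ ef L / 2)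
    (hWe'' : ∀ L : ℕ, 1 < L → 10 ^ 11 * (L : ℝ) ^ 6 * ef L ≤ 1) (hWε'' : ∀ L : ℕ, 1 < L → 10 ^ 16 * (L : ℝ) ^ 5 * α L ≤ 1) :
    (∀ (L : ℕ), 1 < L → ∀ (i : Idx L) (U₀ : GaugeField (i.1.1.P i.1.2.2) 0 (Matrix.specialUnitaryGroup (Fin 2) ℂ)), RegPr i.1.1 i.1.2.1 i.1.2.2 (α L) U₀ →
      ∃ gC : PBond (i.1.1.P i.1.2.1) 0 → Bond 3 (periodsT3 i.1.1 i.1.2.2) → ℝ, (∀ y bb, 0 ≤ gC y bb) ∧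
        (∀ A : Space115 (i.1.1.L : ℝ) (((i.1.1.L : ℝ)⁻¹) ^ (i.1.2.2 - i.1.2.1)) (fun _ : Bond 3 (periodsT3 i.1.1 i.1.2.2) => i.1.2.2 - i.1.2.1) (fun _ : Bond 3 (periodsT3 i.1.1 i.1.2.2) × Fin 3 => i.1.2.2 - i.1.2.1) (nabla115 (((i.1.1.L : ℝ)⁻¹) ^ (i.1.2.2 - i.1.2.1)) (bgOfCfg i.1.1 i.1.2.2 U₀)), ‖A‖ < εC L + a₃ L → ∀ (bb : Bond 3 (periodsT3 i.1.1 i.1.2.2)) (X : Matrix (Fin 2) (Fin 2) ℂ) (y : PBond (i.1.1.P i.1.2.1) 0),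
          ‖fderiv ℂ (fun A' : Space115 (i.1.1.L : ℝ) (((i.1.1.L : ℝ)⁻¹) ^ (i.1.2.2 - i.1.2.1)) (fun _ : Bond 3 (periodsT3 i.1.1 i.1.2.2) => i.1.2.2 - i.1.2.1) (fun _ : Bond 3 (periodsT3 i.1.1 i.1.2.2) × Fin 3 => i.1.2.2 - i.1.2.1) (nabla115 (((i.1.1.L : ℝ)⁻¹) ^ (i.1.2.2 - i.1.2.1)) (bgOfCfg i.1.1 i.1.2.2 U₀)) =>
          (-Complex.I) • CmapTwS i.1.1 i.1.2.1 i.1.2.2 i.2.2.le U₀ (((((eta i.1.1 i.1.2.1 i.1.2.2 : ℝ) : ℂ)) * Complex.I) • (fun b : PBond (i.1.1.P i.1.2.2) 0 => JetSup.equiv _ _ _ A' (bondEquiv i.1.1 i.1.2.2 b)))) A (single115 bb X) y‖ ≤ gC y bb * ‖A‖ * ‖X‖) ∧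
        (∀ bb : Bond 3 (periodsT3 i.1.1 i.1.2.2), ∑ y : PBond (i.1.1.P i.1.2.1) 0, gC y bb ≤ 6 * (10 ^ 11 * (L : ℝ) ^ 5) * (((L : ℝ) ^ (i.1.2.2 - i.1.2.1)) ^ 3)⁻¹)) :=
  hCcol_of_157_family α a₃ εC ef (fun L => 10 ^ 11 * (L : ℝ) ^ 5) hα hef hWe hWε hdomC (fun L _ => by positivity)
    (hC157_family α a₃ εC ef hα hWe hWε hdomC hWe'' hWε'')

end Summit.QuantumFields.YangMills.Theorems.Prop7CovKernel157Family

end
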